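import Summits.HubbardSuperconductivity.HubbardSuperconductivity.Theorems.WidthHaldaneBridge.Negative.UniformThermoVoidRegion
import Summits.HubbardSuperconductivity.HubbardSuperconductivity.Theorems.WidthHaldaneTubeKinematics

/-!
# `WidthUniformThermodynamics` (stmt-HubbardSuperconductivity-16312), negative side: reduction of a
# refutation to the square torus (what the crux asserts in two dimensions), and the bookkeeping of
# its thresholds

The crux is `∃ U > 0, δ ∈ (0, 3/10), d₀ > 0, k₀, M₁, L₀, UniformThermo U δ d₀ k₀ M₁ L₀`
(`widthUniformThermodynamics_iff`). Its width-uniform family `M₁ ≤ M ≤ L` CONTAINS the square tori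
`M = L`, on which the tube Hamiltonian, its seam twist and its filling are the Literature objects
`hubbardTorus 2 L 1 U`, `seamTwist L θ`, `2⌊(1-δ)L²/2⌋` (`tubeEnergy_diag_eq_fluxEnergy`,
`tubeH0_diag_eq_hubbardTorus`, file `WidthHaldaneBridge/Negative/UniformThermoVoidRegion.lean`). This
file records, sorry-free, the two-dimensional statements the crux therefore already contains — the
reason it has the strength of an open problem (`T = 0` superfluid stiffness and a two-sided
`O(1/L²)` pair-charge-gap window of the doped repulsive Hubbard model on the square torus) — and the
monotonicity of its data:

* `uniformThermo_mono` — `UniformThermo` is antitone in `d₀`, monotone in `k₀, M₁, L₀`;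
* `uniformThermo_zero_threshold`, `widthUniformThermodynamics_iff_zero_threshold` — the length cut-off
  `L₀` is DECORATION: it is absorbed by the width threshold (`M₁ ↦ max M₁ L₀`, `L₀ ↦ 0`), so the crux
  is `∃ U > 0, δ, d₀ > 0, k₀, M₁, UniformThermo U δ d₀ k₀ M₁ 0` — thermodynamics of ALL even tubes
  `M₁ ≤ M ≤ L`, including the nearly square ones, not only of long tubes;
* `torusFluxStiffness_of_widthUniformThermodynamics` — the crux implies a `T = 0` FLUX STIFFNESS of
  the two-dimensional torus at the fixed twist `π/3`: `∃ U > 0, δ ∈ (0,3/10), c > 0, L₀` with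
  `c ≤ E^T_L(U,δ; π/3) − E^T_L(U,δ; 0)` for all even `L ≥ L₀` (`E^T = fluxEnergy`, the sector-minimum
  flux envelope of `hubbardTorusFlux`; this is the `θ = π/3` instance of the torus clause of
  `Theses.FluxSpectroscopy.FluxWindow`);
* `torusPairGapWindow_of_widthUniformThermodynamics` — and a two-sided PAIR CHARGE-GAP WINDOW on the
  torus: `0 < E_L(N+2) + E_L(N−2) − 2E_L(N) ≤ 4k₀/L²` for all even `L ≥ L₀`, `E_L(N)` the
  `(N, S^z=0)` floor of `hubbardTorus 2 L 1 U`, `N = 2⌊(1−δ)L²/2⌋`;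
* `widthUniformThermodynamics_false_of_torusFluxSoft`,
  `widthUniformThermodynamics_false_of_torusPairGapDegenerate` — the contrapositives: a refutation
  of the crux follows from EITHER two-dimensional negation alone — softness of the `π/3` flux
  envelope of the square torus cofinally in `L` at every `(U > 0, δ ∈ (0,3/10))`, or failure of the
  pair charge-gap window there (a vanishing/negative second difference, or one exceeding every
  `4k₀/L²` cofinally). Neither hypothesis is constructible in the tree today (both are the open
  two-dimensional physics read from the other side; at `U = 0` the second one IS constructed in
  `ZeroCouplingCompressibility.lean`).

No definitions, no named facts; sources for the objects: Scalapino–White–Zhang, PRB 47 (1993) 7995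
§II (flux stiffness, charge-gap criteria); Byers–Yang, PRL 7 (1961) 46.
-/

noncomputable section

namespace Summit.HubbardSuperconductivity.HubbardSuperconductivity.Theorems.WidthUniformThermodynamics.Negative

set_option linter.dupNamespace false -- summit = problem name (single-conjunct summit), D-0017

open scoped BigOperators Classical Matrix ComplexConjugate
open Matrix Finset Literature.MathematicalPhysics.QuantumLattice Literature.Probability.LatticeModels
open Summit.HubbardSuperconductivity.HubbardSuperconductivity.Theorems.WidthHaldane
open Summit.HubbardSuperconductivity.HubbardSuperconductivity.Theorems.WidthHaldaneBridge.Negative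
open Summit.HubbardSuperconductivity.HubbardSuperconductivity.Theses.WidthHaldane
  (WidthUniformThermodynamics)

/-! ### Monotonicity of the data and the decorative length cut-off -/

/-- **`UniformThermo` is antitone in the stiffness floor and monotone in the compressibility ceiling
and in both thresholds.** [folklore] -/
theorem uniformThermo_mono {U δ d₀ d₀' k₀ k₀' : ℝ} {M₁ M₁' L₀ L₀' : ℕ} (hd : d₀' ≤ d₀) (hk : k₀ ≤ k₀')
    (hM : M₁ ≤ M₁') (hL : L₀ ≤ L₀') (h : UniformThermo U δ d₀ k₀ M₁ L₀) :
    UniformThermo U δ d₀' k₀' M₁' L₀' := by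
  intro L M _ _ hLe hMe hM₁ hML hL₀ Λ _ _ e
  obtain ⟨h1, h2, h3⟩ := h L M hLe hMe (hM.trans hM₁) hML (hL.trans hL₀) Λ e
  exact ⟨hd.trans h1, h2, h3.trans hk⟩

/-- **The length cut-off is absorbed by the width threshold**: `UniformThermo U δ d₀ k₀ M₁ L₀`
implies `UniformThermo U δ d₀ k₀ (max M₁ L₀) 0` (an admissible `(L, M)` for the latter has
`L ≥ M ≥ max M₁ L₀`). [folklore] -/
theorem uniformThermo_zero_threshold {U δ d₀ k₀ : ℝ} {M₁ L₀ : ℕ} (h : UniformThermo U δ d₀ k₀ M₁ L₀) :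
    UniformThermo U δ d₀ k₀ (max M₁ L₀) 0 := by
  intro L M _ _ hLe hMe hM₁ hML _ Λ _ _ e
  exact h L M hLe hMe ((le_max_left _ _).trans hM₁) hML ((le_max_right _ _).trans (hM₁.trans hML)) Λ e

/-- **`L₀` is decoration in the crux**: `WidthUniformThermodynamics` is equivalent to its instance
with length cut-off `0` — the width-uniform thermodynamics is demanded of EVERY even tube with
`M₁ ≤ M ≤ L` (in particular of the square and nearly square tori beyond `M₁`). [folklore] -/
theorem widthUniformThermodynamics_iff_zero_threshold :
    WidthUniformThermodynamics ↔
      ∃ U : ℝ, 0 < U ∧ ∃ δ ∈ Set.Ioo (0 : ℝ) (3 / 10), ∃ d₀ : ℝ, 0 < d₀ ∧ ∃ k₀ : ℝ, ∃ M₁ : ℕ,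
        UniformThermo U δ d₀ k₀ M₁ 0 := by
  rw [widthUniformThermodynamics_iff]
  constructor
  · rintro ⟨U, hU, δ, hδ, d₀, hd₀, k₀, M₁, L₀, h⟩
    exact ⟨U, hU, δ, hδ, d₀, hd₀, k₀, max M₁ L₀, uniformThermo_zero_threshold h⟩
  · rintro ⟨U, hU, δ, hδ, d₀, hd₀, k₀, M₁, h⟩
    exact ⟨U, hU, δ, hδ, d₀, hd₀, k₀, M₁, 0, h⟩

/-! ### The two-dimensional content of the crux (its diagonal `M = L`) -/

/-- **The crux asserts a `T = 0` flux stiffness of the two-dimensional Hubbard torus.**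
`WidthUniformThermodynamics` implies: `∃ U > 0, δ ∈ (0, 3/10), c > 0, L₀` such that for every even
`L ≥ L₀` the sector-minimum flux envelope of `hubbardTorusFlux L U` at filling `2⌊(1-δ)L²/2⌋`
rises by at least `c` between the twists `0` and `π/3`: `c ≤ E^T_L(π/3) − E^T_L(0)` (read clause (i)
`d₀ ≤ ρ̃_{L,L} = 2L[E(π/3) − E(0)]/((π/3)² L)` on the diagonal, `c = d₀ (π/3)²/2`;
`tubeEnergy_diag_eq_fluxEnergy`). Scalapino–White–Zhang (1993) §II. [folklore] -/
theorem torusFluxStiffness_of_widthUniformThermodynamics (h : WidthUniformThermodynamics) :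
    ∃ U : ℝ, 0 < U ∧ ∃ δ ∈ Set.Ioo (0 : ℝ) (3 / 10), ∃ c : ℝ, 0 < c ∧ ∃ L₀ : ℕ,
      ∀ (L : ℕ) [NeZero L], Even L → L₀ ≤ L →
        c ≤ fluxEnergy L U δ (Real.pi / 3) - fluxEnergy L U δ 0 := by
  rw [widthUniformThermodynamics_iff] at h
  obtain ⟨U, hU, δ, hδ, d₀, hd₀, k₀, M₁, L₀, hth⟩ := h
  refine ⟨U, hU, δ, hδ, d₀ * (Real.pi / 3) ^ 2 / 2, by positivity, max M₁ L₀, ?_⟩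
  intro L _ hLe hL
  obtain ⟨e, he, hes⟩ := exists_diagLabel L
  obtain ⟨h1, -, -⟩ := hth L L hLe hLe ((le_max_left _ _).trans hL) le_rfl
    ((le_max_right _ _).trans hL) (FermionTorus 2 L) e
  rw [tubeStiffness_eq, tubeEnergy_diag_eq_fluxEnergy U δ _ e he hes,
    tubeEnergy_diag_eq_fluxEnergy U δ _ e he hes] at h1
  have hLpos : (0 : ℝ) < L := Nat.cast_pos.2 (NeZero.pos L)
  have hpi : (0 : ℝ) < (Real.pi / 3) ^ 2 := by positivity
  rw [le_div_iff₀ (by positivity)] at h1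
  -- `h1 : d₀ * ((π/3)² * L) ≤ 2 * L * Δ`
  have h2 : d₀ * (Real.pi / 3) ^ 2 ≤ 2 * (fluxEnergy L U δ (Real.pi / 3) - fluxEnergy L U δ 0) := by
    have := h1
    nlinarith
  linarith

/-- **The crux asserts a two-sided pair charge-gap window on the two-dimensional torus.**
`WidthUniformThermodynamics` implies: `∃ U > 0, δ ∈ (0, 3/10), k₀, L₀` such that for every even
`L ≥ L₀`, with `E_L(N)` the `(N, S^z = 0)` floor of `hubbardTorus 2 L 1 U` and `N = 2⌊(1-δ)L²/2⌋`,
`0 < E_L(N+2) + E_L(N−2) − 2E_L(N)` and `L² [E_L(N+2) + E_L(N−2) − 2E_L(N)] ≤ 4k₀` (clauses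
(ii)–(iii) `0 < ẽ″_{L,L} ≤ k₀` on the diagonal; `tubeEnergy_zero`, `tubeH0_diag_eq_hubbardTorus`).
Scalapino–White–Zhang (1993) §II. [folklore] -/
theorem torusPairGapWindow_of_widthUniformThermodynamics (h : WidthUniformThermodynamics) :
    ∃ U : ℝ, 0 < U ∧ ∃ δ ∈ Set.Ioo (0 : ℝ) (3 / 10), ∃ k₀ : ℝ, ∃ L₀ : ℕ,
      ∀ (L : ℕ) [NeZero L], Even L → L₀ ≤ L →
        0 < (hubbardTorus 2 L 1 U).minEnergyOn (szSector (Λ := FermionTorus 2 L)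
              (2 * ⌊(1 - δ) * (L : ℝ) ^ 2 / 2⌋₊ + 2) 0) +
            (hubbardTorus 2 L 1 U).minEnergyOn (szSector (Λ := FermionTorus 2 L)
              (2 * ⌊(1 - δ) * (L : ℝ) ^ 2 / 2⌋₊ - 2) 0) -
          2 * (hubbardTorus 2 L 1 U).minEnergyOn (szSector (Λ := FermionTorus 2 L)
              (2 * ⌊(1 - δ) * (L : ℝ) ^ 2 / 2⌋₊) 0) ∧
        (L : ℝ) ^ 2 * ((hubbardTorus 2 L 1 U).minEnergyOn (szSector (Λ := FermionTorus 2 L)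
              (2 * ⌊(1 - δ) * (L : ℝ) ^ 2 / 2⌋₊ + 2) 0) +
            (hubbardTorus 2 L 1 U).minEnergyOn (szSector (Λ := FermionTorus 2 L)
              (2 * ⌊(1 - δ) * (L : ℝ) ^ 2 / 2⌋₊ - 2) 0) -
          2 * (hubbardTorus 2 L 1 U).minEnergyOn (szSector (Λ := FermionTorus 2 L)
              (2 * ⌊(1 - δ) * (L : ℝ) ^ 2 / 2⌋₊) 0)) ≤ 4 * k₀ := by
  rw [widthUniformThermodynamics_iff] at h
  obtain ⟨U, hU, δ, hδ, d₀, -, k₀, M₁, L₀, hth⟩ := h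
  refine ⟨U, hU, δ, hδ, k₀, max M₁ L₀, ?_⟩
  intro L _ hLe hL
  obtain ⟨e, he, -⟩ := exists_diagLabel L
  obtain ⟨-, h2, h3⟩ := hth L L hLe hLe ((le_max_left _ _).trans hL) le_rfl
    ((le_max_right _ _).trans hL) (FermionTorus 2 L) e
  rw [tubePairCompressibility_eq, tubeEnergy_zero, tubeEnergy_zero, tubeEnergy_zero,
    tubeH0_diag_eq_hubbardTorus U e he, tubeFilling_diag] at h2 h3
  set Δ : ℝ := (hubbardTorus 2 L 1 U).minEnergyOn (szSector (Λ := FermionTorus 2 L)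
        (2 * ⌊(1 - δ) * (L : ℝ) ^ 2 / 2⌋₊ + 2) 0) +
      (hubbardTorus 2 L 1 U).minEnergyOn (szSector (Λ := FermionTorus 2 L)
        (2 * ⌊(1 - δ) * (L : ℝ) ^ 2 / 2⌋₊ - 2) 0) -
    2 * (hubbardTorus 2 L 1 U).minEnergyOn (szSector (Λ := FermionTorus 2 L)
        (2 * ⌊(1 - δ) * (L : ℝ) ^ 2 / 2⌋₊) 0) with hΔ
  have hLpos : (0 : ℝ) < L := Nat.cast_pos.2 (NeZero.pos L)
  have hLL : (0 : ℝ) < (L : ℝ) * (L : ℝ) := by positivity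
  constructor
  · -- `0 < L·L·Δ₂/4` ⇒ `0 < Δ₂`
    by_contra hneg
    push Not at hneg
    have : (L : ℝ) * (L : ℝ) * Δ / 4 ≤ 0 :=
      div_nonpos_of_nonpos_of_nonneg (mul_nonpos_of_nonneg_of_nonpos hLL.le hneg) (by norm_num)
    linarith
  · rw [sq]
    have := h3
    rw [div_le_iff₀ (by norm_num : (0 : ℝ) < 4)] at this
    linarith

/-! ### Contrapositives: two-dimensional hypotheses that refute the crux -/

/-- **A soft `π/3` flux envelope of the square torus refutes the crux.** If for every `U > 0`,
`δ ∈ (0, 3/10)`, `c > 0` and `L₀` some even `L ≥ L₀` has `E^T_L(U,δ; π/3) − E^T_L(U,δ; 0) < c`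
(no `T = 0` flux stiffness of the two-dimensional torus at the fixed twist, cofinally in `L`), then
`WidthUniformThermodynamics` is false. [folklore] -/
theorem widthUniformThermodynamics_false_of_torusFluxSoft
    (hsoft : ∀ U : ℝ, 0 < U → ∀ δ ∈ Set.Ioo (0 : ℝ) (3 / 10), ∀ c : ℝ, 0 < c → ∀ L₀ : ℕ,
      ∃ L : ℕ, ∃ _ : NeZero L, Even L ∧ L₀ ≤ L ∧
        fluxEnergy L U δ (Real.pi / 3) - fluxEnergy L U δ 0 < c) :
    ¬ WidthUniformThermodynamics := by
  intro h
  obtain ⟨U, hU, δ, hδ, c, hc, L₀, hstiff⟩ := torusFluxStiffness_of_widthUniformThermodynamics h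
  obtain ⟨L, _, hLe, hL, hlt⟩ := hsoft U hU δ hδ c hc L₀
  exact absurd (hstiff L hLe hL) (not_le.mpr hlt)

/-- **A degenerate or divergent pair charge gap of the square torus refutes the crux.** If for every
`U > 0`, `δ ∈ (0, 3/10)`, `k₀` and `L₀` some even `L ≥ L₀` has second difference
`Δ₂ = E_L(N+2) + E_L(N−2) − 2E_L(N)` (`E_L` the `(·, S^z = 0)` floors of `hubbardTorus 2 L 1 U`,
`N = 2⌊(1-δ)L²/2⌋`) with `Δ₂ ≤ 0` or `4k₀ < L² Δ₂`, then `WidthUniformThermodynamics` is false.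
[folklore] -/
theorem widthUniformThermodynamics_false_of_torusPairGapDegenerate
    (hgap : ∀ U : ℝ, 0 < U → ∀ δ ∈ Set.Ioo (0 : ℝ) (3 / 10), ∀ k₀ : ℝ, ∀ L₀ : ℕ,
      ∃ L : ℕ, ∃ _ : NeZero L, Even L ∧ L₀ ≤ L ∧
        ((hubbardTorus 2 L 1 U).minEnergyOn (szSector (Λ := FermionTorus 2 L)
              (2 * ⌊(1 - δ) * (L : ℝ) ^ 2 / 2⌋₊ + 2) 0) +
            (hubbardTorus 2 L 1 U).minEnergyOn (szSector (Λ := FermionTorus 2 L)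
              (2 * ⌊(1 - δ) * (L : ℝ) ^ 2 / 2⌋₊ - 2) 0) -
          2 * (hubbardTorus 2 L 1 U).minEnergyOn (szSector (Λ := FermionTorus 2 L)
              (2 * ⌊(1 - δ) * (L : ℝ) ^ 2 / 2⌋₊) 0) ≤ 0 ∨
        4 * k₀ < (L : ℝ) ^ 2 * ((hubbardTorus 2 L 1 U).minEnergyOn (szSector (Λ := FermionTorus 2 L)
              (2 * ⌊(1 - δ) * (L : ℝ) ^ 2 / 2⌋₊ + 2) 0) +
            (hubbardTorus 2 L 1 U).minEnergyOn (szSector (Λ := FermionTorus 2 L)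
              (2 * ⌊(1 - δ) * (L : ℝ) ^ 2 / 2⌋₊ - 2) 0) -
          2 * (hubbardTorus 2 L 1 U).minEnergyOn (szSector (Λ := FermionTorus 2 L)
              (2 * ⌊(1 - δ) * (L : ℝ) ^ 2 / 2⌋₊) 0)))) :
    ¬ WidthUniformThermodynamics := by
  intro h
  obtain ⟨U, hU, δ, hδ, k₀, L₀, hwin⟩ := torusPairGapWindow_of_widthUniformThermodynamics h
  obtain ⟨L, _, hLe, hL, hbad⟩ := hgap U hU δ hδ k₀ L₀
  obtain ⟨hpos, hle⟩ := hwin L hLe hL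
  rcases hbad with hnonpos | hbig
  · exact absurd hpos (not_lt.mpr hnonpos)
  · exact absurd hle (not_le.mpr hbig)

end Summit.HubbardSuperconductivity.HubbardSuperconductivity.Theorems.WidthUniformThermodynamics.Negative

end
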